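import Mathlib
import HarnessLib
import Summits.Langlands.Langlands.Theses.ParahoricFibre
import Literature.NumberTheory.GaloisRepresentations.WeilDeligneGeneric

/-!
# Birth skeleton (BC3) for crux stmt-Langlands-18195
`Summit.Langlands.Langlands.Theses.ParahoricFibre.SmallRangeGenericMonodromy` — line `birth`

Route `route-Langlands-ParahoricFibre` (rev 0; `closes (hOcc : ParahoricOccurrence)
(hOG : OccurrenceToGeneric) (hSmall : SmallRangeGenericMonodromy) (hJ : MonodromyToLanglands)
(hA : Assembly) : Langlands`; this crux is `hSmall`, rank 4, difficulty open-problem, declared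
`deps: ParahoricOccurrence`).  THE CRUX: for `K` CM, `π` regular algebraic cuspidal on
`GL_n(𝔸_K)`, a prime `p`, `ι : ℚ̄_p ≃ ℂ` and a SEMISIMPLE `ρ : Γ_K → GL_n(ℚ̄_p)` with the
Satake-predicted arithmetic-Frobenius characteristic polynomials at cofinitely many places, if
the datum `(p, ρ)` is NOT in the route's PATCHING RANGE (`p > n²`, `p ∤ disc K`, `π` unramified
above `p`, an integral model `gρg⁻¹` whose reduction contains `SL_n(𝔽_p)`, a decomposed generic
prime `l ≠ p`), then at every finite `v ∤ p` some Weil–Deligne representation attached to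
`ρ|_{W_{K_v}}` (Grothendieck–Deligne, `IsWeilDeligneOfLadic`) is GENERIC (the inline clause is
literally `WeilDeligneRep.IsGeneric`, `isGeneric_iff` = `Iff.rfl`).

## The line: small monodromy ∨ (full monodromy + prime switch through the route's own lever)

The patching range is a condition on the PAIR `(p, ρ)`, but whether it can EVER be met is a
property of `π` alone: by Chebotarev + Brauer–Nesbitt `ρ ≅ r_{p,ι}(π)`, so the data Satake-
compatible with `π` form the compatible system `{r_{p',ι'}(π)}`; by Larsen's maximality theorem
(Duke 1995) its residual images contain `SL_n(𝔽_{p'})` for a density-one set of `p'` as soon as the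
algebraic monodromy group contains `SL_n`, and then the remaining range conditions
(`p' > n²`, `p' ∤ disc K`, `π` unramified above `p'`, a decomposed generic prime — Matsumoto
Lemma 6.3 / ACC+ §6: "for almost all `l`") exclude finitely many or density-zero many `p'`.  So
EITHER `π` admits NO patching datum at any prime `p' ≠ char(v)` ("small monodromy": `π`
polarizable with `n ≥ 3`, automorphically induced, a symmetric-power / tensor lift, or of proper
algebraic monodromy `G ⊉ SL_n`), OR it admits one at some `p' ∤ v` ("full monodromy"), where the
route's lever applies: `ParahoricOccurrence` + `OccurrenceToGeneric` (the route's items, consumed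
BY NAME) give genericity of `WD(r_{p',ι'}(π)|_v)`, i.e. full local–global compatibility at `v` for
ONE good prime, and what is left is to move genericity inside the compatible system from `p'` to
the given `p` — the `ℓ`-INDEPENDENCE OF THE MONODROMY OPERATOR at `v`, the problem every author
names as the obstacle (Matsumoto arXiv:2312.01551 p. 2: in the conjugate self-dual case "the
correspondence of the monodromy operators at `v ∤ l` has been proved by showing the weight
monodromy conjecture (purity)"; "in general such a geometric interpretation of `r_ι(π)` is not
known"; AllenNewton2020 p. 1; A'Campo–Hevesi–Thorne–Whitmore arXiv:2607.11763 p. 4: only the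
semisimplified statement is known for non-self-dual `π`).  The skeleton cuts the crux exactly there:

* `stub_genericityPrimeSwitch` (XL, the OPEN CORE — said openly): for `π` as above, a datum
  `(p, ι, ρ)` and a PATCHING datum `(p', ι', ρ')` (both semisimple and Satake-compatible with `π`
  cofinitely, `(p', ρ')` in the range) and a place `v ∤ pp'`: if some Weil–Deligne representation
  attached to `ρ'|_{W_{K_v}}` is generic, then some Weil–Deligne representation attached to
  `ρ|_{W_{K_v}}` is generic.  With Varma's envelope (`WD(r_p(π)|_v)^{F-ss} ≺ rec(π_v)`, all `p`;
  VarmaFMS2024) both sides are "`N_p` is as large as `N_π`", so the stub says: local–global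
  compatibility at `v` does not depend on the prime — Fontaine–Serre `ℓ`-independence of the
  Weil–Deligne representation for the automorphic compatible system, monodromy included.  Known:
  polarizable `π` (Taylor–Yoshida, Shin, Caraiani2012: purity at every `ℓ`); `n ≤ 2` with the
  hypotheses of AllenNewton2020 / Matsumoto Thm. 1.5 only prime-by-prime; places `v` where
  `rec(π_v)` has `N = 0` (trivial from Varma).  OPEN in general; it would turn Matsumoto's
  positive-density theorems (arXiv:2312.01551 Thms. 1.3, 1.5) into all-`l` theorems.  No purity /
  geometric realisation of `r_p(π)` is available for non-polarizable `π` — that is why it is XL.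
* `stub_smallMonodromyGeneric` (XL, open in general, with a large PROVED sector): for `π` as
  above admitting NO patching datum at any prime `p' ≠ char(v)` (every semisimple
  Satake-compatible `(p', ι', ρ')` with `p' ∤ v` violates the range), every attached
  `WD(ρ|_{W_{K_v}})`, `v ∤ p`, is generic.  Known: `π` polarizable — Conj. 1.1.2 of
  arXiv:2607.11763 "in complete generality" (TaylorYoshida2007, Caraiani2012, Caraiani2014);
  `π = AI(χ)` automorphically induced (Arthur–Clozel + Henniart–Herb); functorial lifts with known
  local transfer.  Open: `π` non-polarizable whose system has proper algebraic monodromy not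
  explained by a known functoriality.  It is the crux restricted to small-monodromy `π` (a
  strictly stronger hypothesis than "THIS `p` is off-range"), so it does not give the crux back.
* `SmallRangeGenericMonodromy_of : ParahoricOccurrence → OccurrenceToGeneric → stub 1 → stub 2 →
  SmallRangeGenericMonodromy` — kernel-checked, no `sorry`: classical dichotomy on "some patching
  datum `(p', ι', ρ')` with `p' ∤ v` exists"; if yes, `OccurrenceToGeneric ParahoricOccurrence`
  at `(p', ι', ρ', v)` and STUB 1; if no, STUB 2.  The crux's own off-range hypothesis is not
  needed (the dichotomy is by `π`, not by `p`): once the two route items land, the same two stubs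
  prove the shared target `GenericMonodromy` (stmt-Langlands-10863) outright.  Both stubs and
  both route items are load-bearing; the route items enter BY NAME (`@[route_item]`-tagged
  obligations), never restated.

Both stubs are consequences of the summit on paper (each concludes an instance of local–global
compatibility at `v ∤ p`), so neither is refutable short of `¬Langlands`; neither gives the crux
or the summit cheaply (BC3 probes in the registrar's folder `bc/SmallRangeGenericMonodromy_probe*.lean`:
`Sᵢ → SmallRangeGenericMonodromy`, `Sᵢ → Langlands` by `first | exact? | simpa | aesop` FAIL 4/4).
The alternative cut recorded in the route header (planner's unregistered birth file: `PadicSide` —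
same lever with Kisin-type conditions at a bad `p` — plus `ResidualSide`) is a partition by `p`;
this line is the partition by `π`, which lets the route's in-range lever work for the off-range
crux too.  A future `Lines/padic-direct.lean` may register the other cut alongside.

Shape (for `ledger skeleton check` / `#h21_check_skeleton`): stubs `theorem stub_<name> :
<signature> := by sorry` (closed statements over existing tree declarations only, no local
definition inside a signature); `_Goal.stub_<name> : Prop := type_of% @stub_<name>` names each
statement; the composition takes `(hOcc : ParahoricOccurrence) (hOG : OccurrenceToGeneric)
(h₁ : _Goal.stub_genericityPrimeSwitch) (h₂ : _Goal.stub_smallMonodromyGeneric)` and concludes the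
route decl by its fully qualified name; the final `example` feeds the stubs to it.  Sorries:
exactly the two stubs.

Disproof used: none exists — `ledger crux ls stmt-Langlands-18195` lists no workfiles at
registration time (2026-08-17: no `Disproof.lean`, no `Negative/` lemma, no dead line, no crux
idea).  `ledger negatives --problem Langlands` (4 entries: SplitPrimeInductionMonomialSerreAtSplitPrimes,
SplitPrimeInductionDeinduction, OrdinaryPrimeTransportRankinSelbergPoleCount,
K3KugaSatakeDescentSerreTypeAnchor) contains nothing of the shape of these stubs.  Nearest typed
neighbours in the tree: `PrimeSwitchSplit.PadicMemberCompatibility` (a prime switch at `v ∣ ℓ`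
through `D_pst`, irreducible `ρ`, `LocalGlobalCompatibleAt Rec`) and the sibling line
`Cruxes/GenericMonodromy/Lines/birth.lean` (Varma envelope / monodromy-rank lower bound / algebra,
prime by prime) — this line is the `v ∤ pp'` genericity switch between two members, a different
statement from both.
-/

set_option linter.dupNamespace false

noncomputable section

namespace Summit.Langlands.Langlands.Cruxes.SmallRangeGenericMonodromy.Birth

open Summit.Langlands.Langlands.Theses.ParahoricFibre
open scoped NumberField
open IsDedekindDomain NumberField Polynomial Filter
open Literature.NumberTheory.Automorphic Literature.NumberTheory.GaloisRepresentations

/-! ## 1. The two stubs -/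

/-- **STUB 1 — the genericity prime switch (`ℓ`-independence of the monodromy at `v ∤ pp'`
inside the automorphic compatible system; the OPEN CORE of the line).**  Let `K` be CM, `π`
regular algebraic cuspidal on `GL_n(𝔸_K)`, `(p, ι, ρ)` and `(p', ι', ρ')` two data with `ρ`,
`ρ'` semisimple and carrying the Satake-predicted arithmetic-Frobenius characteristic polynomials
of `π` at cofinitely many places (so `ρ ≅ r_{p,ι}(π)`, `ρ' ≅ r_{p',ι'}(π)`), the second one IN THE
PATCHING RANGE (`p' > n²`, `p' ∤ disc K`, `π` unramified above `p'`, an integral model of `ρ'`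
with residual image `⊇ SL_n(𝔽_{p'})`, a decomposed generic prime), and `v` a finite place with
`v ∤ p`, `v ∤ p'`.  If some Weil–Deligne representation attached to `ρ'|_{W_{K_v}}` is generic, then
some Weil–Deligne representation attached to `ρ|_{W_{K_v}}` is generic.  On paper, with Varma's
envelope at both primes (`WD^{F-ss} ≺ ι⁻¹rec(π_v ⊗ |det|^{(1-n)/2})`, equal semisimplifications,
VarmaFMS2024 Thms. 1–2, every prime) and "generic ⇔ maximal for `≺` among representations with the
same traces" (Allen2016 §1.1), hypothesis and conclusion both read `WD(r_•(π)|_v)^{F-ss} ≅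
ι_•⁻¹rec(π_v ⊗ |det|^{(1-n)/2})`: the stub is the independence of the prime of local–global
compatibility at `v`, i.e. `ℓ`-independence of `N` for `{r_λ(π)}` at `v`.  Known: `π` polarizable
(purity at every `ℓ`: TaylorYoshida2007, Caraiani2012); places where `rec(π_v)` has `N = 0`
(Varma alone); nothing else — AllenNewton2020 / arXiv:2312.01551 work prime by prime inside the
range.  OPEN: non-polarizable `π`, `v` with `N_{π_v} ≠ 0`, `p` off-range; no purity or geometric
realisation of `r_p(π)` is available (arXiv:2312.01551 p. 2).  The existence half of the
conclusion (SOME `W` is attached to `ρ|_{W_{K_v}}`) is Grothendieck's `ℓ`-adic monodromy theorem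
(tree named fact `exists_weilDeligneRep_of_ladic`).  Why it might fail: it cannot fail without
local–global compatibility failing at `(π, p, v)`; the recorded risk of the crux (a reducible
`r_ι(π)` whose SEMISIMPLIFICATION has too small an `N`) is exactly a failure of this stub with the
target of the whole route.
[cite: VarmaFMS2024, Thm. 1 and Thm. 2] [cite: Matsumoto2023LGC, §1 p. 2 and Thm. 1.3]
[cite: AllenNewton2020, Thm. 1.1] [cite: Caraiani2012, Thm. 1.1] [cite: Allen2016, §1.1] -/
theorem stub_genericityPrimeSwitch :
    ∀ (K : Type) [Field K] [NumberField K], NumberField.IsCMField K → ∀ (n : ℕ) (hcpt :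
    isCompact_glFiniteIntegralLevel n K) (π : CuspidalAutomorphicRepData n K hcpt),
    π.1.IsRegularAlgebraic → ∀ (p : ℕ) [Fact p.Prime] (ι : PadicAlgCl p ≃+* ℂ) (ρ : FramedGaloisRep
    K (PadicAlgCl p) n), ρ.toGaloisRep.IsSemisimple → (∀ᶠ v : HeightOneSpectrum (𝓞 K) in cofinite, ∀
    α : Multiset ℂ, π.1.HasSatakeParamAt v α → ρ.IsUnramifiedAt v ∧ ρ.HasFrobCharpolyAt v
    (arithFrobPolyOfSatake ι v.residueCard n α)) → ∀ (p' : ℕ) [Fact p'.Prime] (ι' : PadicAlgCl p'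
    ≃+* ℂ) (ρ' : FramedGaloisRep K (PadicAlgCl p') n), ρ'.toGaloisRep.IsSemisimple → (∀ᶠ v :
    HeightOneSpectrum (𝓞 K) in cofinite, ∀ α : Multiset ℂ, π.1.HasSatakeParamAt v α →
    ρ'.IsUnramifiedAt v ∧ ρ'.HasFrobCharpolyAt v (arithFrobPolyOfSatake ι' v.residueCard n α)) → (n
    ^ 2 < p' ∧ ¬ ((p' : ℤ) ∣ NumberField.discr K) ∧ (∀ w : HeightOneSpectrum (𝓞 K), ((p' : ℕ) : 𝓞 K)
    ∈ w.asIdeal → π.1.IsUnramifiedAt w) ∧ (∃ g : GL (Fin n) (PadicAlgCl p'), (∀ (σ :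
    Field.absoluteGaloisGroup K) (i j : Fin n), ‖((g * ρ' σ * g⁻¹ : GL (Fin n) (PadicAlgCl p')) :
    Matrix (Fin n) (Fin n) (PadicAlgCl p')) i j‖ ≤ 1) ∧ (∀ M : Matrix (Fin n) (Fin n) ℤ, M.det = 1 →
    ∃ σ : Field.absoluteGaloisGroup K, ∀ i j : Fin n, ‖((g * ρ' σ * g⁻¹ : GL (Fin n) (PadicAlgCl
    p')) : Matrix (Fin n) (Fin n) (PadicAlgCl p')) i j - ((M i j : ℤ) : PadicAlgCl p')‖ < 1)) ∧ (∃ l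
    : ℕ, l.Prime ∧ l ≠ p' ∧ ∀ w : HeightOneSpectrum (𝓞 K), ((l : ℕ) : 𝓞 K) ∈ w.asIdeal →
    w.residueCard = l ∧ ρ'.IsUnramifiedAt w ∧ ∃ a : Fin n → PadicAlgCl p', ρ'.HasFrobCharpolyAt w (∏
    i, (X - C (a i))) ∧ ∀ i j : Fin n, i ≠ j → ‖a i - a j‖ = 1 ∧ ‖a i - (l : PadicAlgCl p') * a j‖ =
    1)) → ∀ v : HeightOneSpectrum (𝓞 K), ((p : ℕ) : 𝓞 K) ∉ v.asIdeal → ((p' : ℕ) : 𝓞 K) ∉ v.asIdeal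
    → (∃ W : WeilDeligneRep (v.adicCompletion K) (PadicAlgCl p') (Fin n → PadicAlgCl p'),
    IsWeilDeligneOfLadic (ρ'.toLocal v).toWeilGroupHom W ∧ W.IsGeneric) → ∃ W : WeilDeligneRep
    (v.adicCompletion K) (PadicAlgCl p) (Fin n → PadicAlgCl p), IsWeilDeligneOfLadic (ρ.toLocal
    v).toWeilGroupHom W ∧ W.IsGeneric := by
  sorry

/-- **STUB 2 — genericity for `π` of small monodromy (no patching datum at any prime away from
`v`).**  Let `K` be CM, `π` regular algebraic cuspidal on `GL_n(𝔸_K)`, `(p, ι, ρ)` a datum with `ρ`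
semisimple and Satake-compatible with `π` cofinitely, and `v ∤ p` a finite place such that NO datum
`(p', ι', ρ')` with `ρ'` semisimple, Satake-compatible with `π` cofinitely and `p' ∤ v` lies in the
patching range (for every such datum: `p' ≤ n²`, or `p' ∣ disc K`, or `π` ramified above `p'`, or
no integral model with residual image `⊇ SL_n(𝔽_{p'})`, or no decomposed generic prime).  Then some
Weil–Deligne representation attached to `ρ|_{W_{K_v}}` is generic.  Since `r_{p',ι'}(π)` exists for
every `p'` (HarrisLanTaylorThorneRMS2016 Thm. A, Scholze2015) and, by Larsen's maximality theorem
for compatible systems plus Chebotarev for the decomposed generic prime (arXiv:2312.01551 Lemma 6.3,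
Remark 1.2), a system whose algebraic monodromy contains `SL_n` is in range at a density-one set of
`p'`, the hypothesis says that `π` has SMALL MONODROMY: `π` polarizable with `n ≥ 3` (image in
`GSp_n` / `GO_n`), automorphically induced, a symmetric-power or tensor-product lift, or of proper
algebraic monodromy group for an unexplained reason.  Known sector (PROVED in print): `π`
polarizable — local–global compatibility with `N` at every `v ∤ p` and every `p` (TaylorYoshida2007,
Shin, Caraiani2012, Caraiani2014; "Conjecture 1.1.2 is known to hold in complete generality",
arXiv:2607.11763 p. 4); `π = AI(χ)` (Arthur–Clozel, Henniart–Herb); `n ≤ 2` (small monodromy at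
almost all `p'` forces `π` of CM type).  OPEN: non-polarizable `π` of proper algebraic monodromy not
accounted for by a known functorial lift (conjecturally none exist; proving that is a converse to
functoriality).  It is the crux with the strictly stronger hypothesis "no prime is in range" in
place of "this `p` is off-range", so it does not give the crux back; the existence half of the
conclusion is again Grothendieck's monodromy theorem.  Why it might fail: only with local–global
compatibility itself; the danger is vacuity in the other direction (if Larsen + HLTT put EVERY
non-polarizable cuspidal `π` in range somewhere, the open part of this stub is empty and all content
sits in STUB 1 — which would be good news, not a defect).
[cite: Caraiani2012, Thm. 1.1] [cite: TaylorYoshida2007, Thm. 1.1] [cite: Caraiani2014, Thm. 1.1]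
[cite: Matsumoto2023LGC, Lemma 6.3 and Remark 1.2] [cite: HarrisLanTaylorThorneRMS2016, Thm. A] -/
theorem stub_smallMonodromyGeneric :
    ∀ (K : Type) [Field K] [NumberField K], NumberField.IsCMField K → ∀ (n : ℕ) (hcpt :
    isCompact_glFiniteIntegralLevel n K) (π : CuspidalAutomorphicRepData n K hcpt),
    π.1.IsRegularAlgebraic → ∀ (p : ℕ) [Fact p.Prime] (ι : PadicAlgCl p ≃+* ℂ) (ρ : FramedGaloisRep
    K (PadicAlgCl p) n), ρ.toGaloisRep.IsSemisimple → (∀ᶠ v : HeightOneSpectrum (𝓞 K) in cofinite, ∀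
    α : Multiset ℂ, π.1.HasSatakeParamAt v α → ρ.IsUnramifiedAt v ∧ ρ.HasFrobCharpolyAt v
    (arithFrobPolyOfSatake ι v.residueCard n α)) → ∀ v : HeightOneSpectrum (𝓞 K), ((p : ℕ) : 𝓞 K) ∉
    v.asIdeal → (∀ (p' : ℕ) [Fact p'.Prime] (ι' : PadicAlgCl p' ≃+* ℂ) (ρ' : FramedGaloisRep K
    (PadicAlgCl p') n), ρ'.toGaloisRep.IsSemisimple → (∀ᶠ v : HeightOneSpectrum (𝓞 K) in cofinite, ∀
    α : Multiset ℂ, π.1.HasSatakeParamAt v α → ρ'.IsUnramifiedAt v ∧ ρ'.HasFrobCharpolyAt v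
    (arithFrobPolyOfSatake ι' v.residueCard n α)) → ((p' : ℕ) : 𝓞 K) ∉ v.asIdeal → ¬ (n ^ 2 < p' ∧ ¬
    ((p' : ℤ) ∣ NumberField.discr K) ∧ (∀ w : HeightOneSpectrum (𝓞 K), ((p' : ℕ) : 𝓞 K) ∈ w.asIdeal
    → π.1.IsUnramifiedAt w) ∧ (∃ g : GL (Fin n) (PadicAlgCl p'), (∀ (σ : Field.absoluteGaloisGroup
    K) (i j : Fin n), ‖((g * ρ' σ * g⁻¹ : GL (Fin n) (PadicAlgCl p')) : Matrix (Fin n) (Fin n)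
    (PadicAlgCl p')) i j‖ ≤ 1) ∧ (∀ M : Matrix (Fin n) (Fin n) ℤ, M.det = 1 → ∃ σ :
    Field.absoluteGaloisGroup K, ∀ i j : Fin n, ‖((g * ρ' σ * g⁻¹ : GL (Fin n) (PadicAlgCl p')) :
    Matrix (Fin n) (Fin n) (PadicAlgCl p')) i j - ((M i j : ℤ) : PadicAlgCl p')‖ < 1)) ∧ (∃ l : ℕ,
    l.Prime ∧ l ≠ p' ∧ ∀ w : HeightOneSpectrum (𝓞 K), ((l : ℕ) : 𝓞 K) ∈ w.asIdeal → w.residueCard =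
    l ∧ ρ'.IsUnramifiedAt w ∧ ∃ a : Fin n → PadicAlgCl p', ρ'.HasFrobCharpolyAt w (∏ i, (X - C (a
    i))) ∧ ∀ i j : Fin n, i ≠ j → ‖a i - a j‖ = 1 ∧ ‖a i - (l : PadicAlgCl p') * a j‖ = 1))) → ∃ W :
    WeilDeligneRep (v.adicCompletion K) (PadicAlgCl p) (Fin n → PadicAlgCl p), IsWeilDeligneOfLadic
    (ρ.toLocal v).toWeilGroupHom W ∧ W.IsGeneric := by
  sorry

/-! ## 2. The stub statements as named propositions (the composition's hypotheses, by name)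

`_Goal` is internal on purpose: audits listing the file's declarations by short name find the
`stub_*` THEOREMS, while `#h21_check_skeleton` accepts the hypotheses of
`SmallRangeGenericMonodromy_of` by the stub names they carry.  Each `_Goal.stub_x` is
`type_of% @stub_x` — no text duplicated, no `sorry` inherited. -/

namespace _Goal

/-- The statement of `stub_genericityPrimeSwitch`, as a named `Prop` (literally its type).
[folklore] -/
def stub_genericityPrimeSwitch : Prop :=
  type_of% @Summit.Langlands.Langlands.Cruxes.SmallRangeGenericMonodromy.Birth.stub_genericityPrimeSwitch

/-- The statement of `stub_smallMonodromyGeneric`, as a named `Prop` (literally its type).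
[folklore] -/
def stub_smallMonodromyGeneric : Prop :=
  type_of% @Summit.Langlands.Langlands.Cruxes.SmallRangeGenericMonodromy.Birth.stub_smallMonodromyGeneric

end _Goal

/-! ## 3. The composition (kernel-checked, no `sorry`): dichotomy by `π`; full monodromy ⇒ the
route's lever at a good prime `p' ∤ v` + the prime switch; small monodromy ⇒ stub 2 -/

/-- **`SmallRangeGenericMonodromy` from the route's in-range items and the two stubs.**  Fix the
data of the crux and a place `v ∤ p`.  Either some PATCHING datum `(p', ι', ρ')` of `π` with
`p' ∤ v` exists — then `OccurrenceToGeneric` applied to `ParahoricOccurrence` (the route's rank-2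
crux and its support, consumed BY NAME) gives a generic Weil–Deligne representation attached to
`ρ'|_{W_{K_v}}`, and STUB 1 moves genericity to `ρ|_{W_{K_v}}` — or none exists, and STUB 2
applies verbatim.  `WeilDeligneRep.IsGeneric` is the crux's inline clause (`isGeneric_iff`).  The
off-range hypothesis of the crux is introduced and not used: the dichotomy is a property of `π`.
Hypotheses, by name: `ParahoricOccurrence`, `OccurrenceToGeneric` (route items) and the statements
of `stub_genericityPrimeSwitch`, `stub_smallMonodromyGeneric`; conclusion: the route decl
`Summit.Langlands.Langlands.Theses.ParahoricFibre.SmallRangeGenericMonodromy`. [folklore] -/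
theorem SmallRangeGenericMonodromy_of (hOcc : ParahoricOccurrence) (hOG : OccurrenceToGeneric)
    (h₁ : _Goal.stub_genericityPrimeSwitch) (h₂ : _Goal.stub_smallMonodromyGeneric) :
    Summit.Langlands.Langlands.Theses.ParahoricFibre.SmallRangeGenericMonodromy := by
  unfold _Goal.stub_genericityPrimeSwitch at h₁
  unfold _Goal.stub_smallMonodromyGeneric at h₂
  intro K _ _ hK n hcpt π hπ p _ ι ρ hss hsat _hoff v hv
  by_cases hfull :
      ∃ (p' : ℕ) (_ : Fact p'.Prime) (ι' : PadicAlgCl p' ≃+* ℂ) (ρ' : FramedGaloisRep K (PadicAlgCl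
      p') n), ρ'.toGaloisRep.IsSemisimple ∧ (∀ᶠ v : HeightOneSpectrum (𝓞 K) in cofinite, ∀ α :
      Multiset ℂ, π.1.HasSatakeParamAt v α → ρ'.IsUnramifiedAt v ∧ ρ'.HasFrobCharpolyAt v
      (arithFrobPolyOfSatake ι' v.residueCard n α)) ∧ ((p' : ℕ) : 𝓞 K) ∉ v.asIdeal ∧ (n ^ 2 < p' ∧ ¬
      ((p' : ℤ) ∣ NumberField.discr K) ∧ (∀ w : HeightOneSpectrum (𝓞 K), ((p' : ℕ) : 𝓞 K) ∈
      w.asIdeal → π.1.IsUnramifiedAt w) ∧ (∃ g : GL (Fin n) (PadicAlgCl p'), (∀ (σ :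
      Field.absoluteGaloisGroup K) (i j : Fin n), ‖((g * ρ' σ * g⁻¹ : GL (Fin n) (PadicAlgCl p')) :
      Matrix (Fin n) (Fin n) (PadicAlgCl p')) i j‖ ≤ 1) ∧ (∀ M : Matrix (Fin n) (Fin n) ℤ, M.det = 1
      → ∃ σ : Field.absoluteGaloisGroup K, ∀ i j : Fin n, ‖((g * ρ' σ * g⁻¹ : GL (Fin n) (PadicAlgCl
      p')) : Matrix (Fin n) (Fin n) (PadicAlgCl p')) i j - ((M i j : ℤ) : PadicAlgCl p')‖ < 1)) ∧ (∃
      l : ℕ, l.Prime ∧ l ≠ p' ∧ ∀ w : HeightOneSpectrum (𝓞 K), ((l : ℕ) : 𝓞 K) ∈ w.asIdeal →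
      w.residueCard = l ∧ ρ'.IsUnramifiedAt w ∧ ∃ a : Fin n → PadicAlgCl p', ρ'.HasFrobCharpolyAt w
      (∏ i, (X - C (a i))) ∧ ∀ i j : Fin n, i ≠ j → ‖a i - a j‖ = 1 ∧ ‖a i - (l : PadicAlgCl p') * a
      j‖ = 1))
  · -- full monodromy: a patching datum `(p', ι', ρ')` with `p' ∤ v`
    obtain ⟨p', hp', ι', ρ', hss', hsat', hv', hrange'⟩ := hfull
    -- the route's lever at `p'`: occurrence ⇒ genericity in the range (items, by name)
    obtain ⟨W', hW', hgen'⟩ := hOG hOcc K hK n hcpt π hπ p' ι' ρ' hss' hsat' hrange' v hv'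
    -- the prime switch `p' ↝ p` at `v`
    obtain ⟨W, hW, hgen⟩ := h₁ K hK n hcpt π hπ p ι ρ hss hsat p' ι' ρ' hss' hsat' hrange' v hv hv'
      ⟨W', hW', (WeilDeligneRep.isGeneric_iff W').mpr hgen'⟩
    exact ⟨W, hW, (WeilDeligneRep.isGeneric_iff W).mp hgen⟩
  · -- small monodromy: no patching datum away from `v`
    obtain ⟨W, hW, hgen⟩ := h₂ K hK n hcpt π hπ p ι ρ hss hsat v hv (by
      intro p' hp' ι' ρ' hss' hsat' hv' hrange'
      exact hfull ⟨p', hp', ι', ρ', hss', hsat', hv', hrange'⟩)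
    exact ⟨W, hW, (WeilDeligneRep.isGeneric_iff W).mp hgen⟩

/-- By-name sanity check (an `example`, not a declaration of the file): the two stubs and the two
route items feed the composition as they stand. -/
example (hOcc : ParahoricOccurrence) (hOG : OccurrenceToGeneric) :
    Summit.Langlands.Langlands.Theses.ParahoricFibre.SmallRangeGenericMonodromy :=
  SmallRangeGenericMonodromy_of hOcc hOG stub_genericityPrimeSwitch stub_smallMonodromyGeneric

end Summit.Langlands.Langlands.Cruxes.SmallRangeGenericMonodromy.Birth

end
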